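import Summits.FinalStateConjecture.FinalStateConjecture.Theses.StarvedNecks
import Literature.Geometry.Lorentzian.KerrData
import Summits.FinalStateConjecture.FinalStateConjecture.Theorems.StarvedNecksHonestFixedRadiusSettlingStubEntryBookkeeping
import Summits.FinalStateConjecture.FinalStateConjecture.Theorems.StarvedNecksHonestFixedRadiusSettlingStubFlatZoneSojourn
import Summits.FinalStateConjecture.FinalStateConjecture.Theorems.StarvedNecksHonestFixedRadiusSettlingStubFarExit
import Summits.FinalStateConjecture.FinalStateConjecture.Theorems.HonestFixedRadiusSettling.Negative.KillShape

/-!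
# Route StarvedNecks — crux `HonestFixedRadiusSettling` (stmt-FinalStateConjecture-13550), line
# `sojourn-needs-only-one-over-delta`: the deterministic wrapper, CLOSED

Two def-free theorems assembling the three landed stubs of the line
(`stub_farExit`, `stub_entryBookkeeping`, `stub_flatZoneSojourn`, all in this namespace):

* `hasCompleteNullInfinity_of_oneAtlas` — **CERT**: a vacuum Cauchy development carrying a `Cᵏ` (`k ≥ 1`)
  final-state decomposition whose flat chart has ONE ATLAS AT INFINITY (the seventeen clauses, verbatim the
  hypotheses of `stub_farExit`: compact core `Bs`, tube-separation rate `κ > 0`, Kerr end `(M, a)` with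
  `0 ≤ M`, `|a| ≤ M`, continuous inner radius profile `R♯ ≥ 16M + |a| + 1` of slope `≤ 2`, ZONE, EXACT
  (`Φ^* g` IS the Kerr metric in Boyer–Lindquist-type time over Kerr–Schild space on the zone), ORIENTED,
  INJECTIVE, ATTACHED ×4, COVER, SEPARATED) has COMPLETE FUTURE NULL INFINITY in Christodoulou's sojourn form
  (`Summit.FinalStateConjecture.HasCompleteNullInfinity`). Proof = the skeleton's `cert_of`: for `s > 0` take
  `δ := min δ₀ (1/(2CLs))`, a chart time after which the flat `Cᵏ` (hence `C¹`) deviation is `≤ δ`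
  (`tendsto_deviationCk_flat` — RATE-FREE), `T := 1/(Cδ)`, and demand exit later than `max τδ ((4T+2)/κ)`
  (`stub_farExit`); a non-complete ray then has an exit event, stays in `J⁺(ι Bs)` afterwards and the
  coordinate cone over the exit point is tube-free (`stub_entryBookkeeping`), and the lever
  (`stub_flatZoneSojourn`) keeps `[s₀, s₀ + (1 − e⁻¹)/(CδL)] ⊆ dom`, an interval of measure `≥ s`.
* `honestFixedRadiusSettling_of_core` — **THE REDUCTION**: the crux `StarvedNecks.HonestFixedRadiusSettling`
  follows from the line's remaining registered stub `stub_core` (Christodoulou-genericity of: MGHD exists,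
  and every MGHD carries an honest `C⁴` fixed-radius decomposition of its self-determined exterior — the
  crux's `Hc`/`Hf` VERBATIM — with one atlas at infinity, and NO `𝓘⁺` clause), by monotonicity of genericity
  (`Negative.isChristodoulouGeneric_mono`) and CERT. The hypothesis is written out in full (def-free), so the
  statement is self-contained: it is exactly `KerrEndedHonestSettlingGeneric` of the skeleton
  `Cruxes/HonestFixedRadiusSettling/Lines/sojourn_needs_only_one_over_delta.lean`.

So the crux is REDUCED to its open-problem core (G minus weak cosmic censorship as a separately argued
clause, on Kerr-ended one-atlas data); nothing here is conditional on an unproved named fact.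
References: line card `Cruxes/HonestFixedRadiusSettling/Lines/sojourn-needs-only-one-over-delta.md`;
Christodoulou, CQG 16 (1999) A23, pp. A26–A27; Dafermos–Rodnianski arXiv:0811.0354 §2.6.2.
-/

set_option linter.dupNamespace false

open Literature.Geometry.Lorentzian
open scoped Manifold ContDiff ENNReal Topology
open Filter Set MeasureTheory Topology

namespace Summit.FinalStateConjecture.FinalStateConjecture.Theorems.StarvedNecks.OneOverDelta

/-- `e⁻¹ ≤ 1/2`. [folklore] -/
theorem exp_neg_one_le_one_half : Real.exp (-1) ≤ 1 / 2 := by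
  have h2 : (2 : ℝ) ≤ Real.exp 1 := by
    have := Real.add_one_le_exp (1 : ℝ)
    linarith
  rw [Real.exp_neg, one_div]
  exact inv_anti₀ (by norm_num) h2

/-- **CERT.** One atlas at infinity (the seventeen clauses, verbatim the hypotheses of `stub_farExit`) and the
structure's own rate-free `deviationCk (flat) k τ → 0` (`k ≥ 1`) give complete future null infinity in the
sojourn form: compose `stub_farExit` (exit event with chart rate `≤ L` or completeness),
`stub_entryBookkeeping` (`J⁺(ι Bs)`-membership after the exit, tube-free coordinate cone) and
`stub_flatZoneSojourn` (affine sojourn `≥ (1 − e^{−CδT})/(CδL)` after the exit), with `δ := min δ₀ (1/(2CLs))`,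
`T := 1/(Cδ)`. Christodoulou, CQG 16 (1999) A23, pp. A26–A27 (the notion certified). [folklore] -/
theorem hasCompleteNullInfinity_of_oneAtlas :
    let blH : ℝ → ℝ → ℝ → ℝ := fun M a r ↦
      Real.smoothTransition (r / (4 * M) - 1) *
        ((M / Real.sqrt (M ^ 2 - a ^ 2)) *
            (Kerr.rPlus M a * Real.log (r - Kerr.rPlus M a) - Kerr.rMinus M a * Real.log (r - Kerr.rMinus M a)) -
          (M / Real.sqrt (M ^ 2 - a ^ 2)) *
            (Kerr.rPlus M a * Real.log (4 * M - Kerr.rPlus M a) -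
              Kerr.rMinus M a * Real.log (4 * M - Kerr.rMinus M a)))
    let toKS : ℝ → ℝ → E4 → E4 := fun M a y ↦
      E4.ofTimeSpace (y 0 + blH M a (Kerr.radius a (E4.ofTimeSpace 0 (E4.spatial y)))) (E4.spatial y)
    let gBL : ℝ → ℝ → E4 → E4 →L[ℝ] E4 →L[ℝ] ℝ := fun M a y ↦
      (Kerr.bilin M a (toKS M a y)).bilinearComp (fderiv ℝ (toKS M a) y) (fderiv ℝ (toKS M a) y)
    ∀ (X : Type) [TopologicalSpace X] [ChartedSpace E3 X] [IsManifold (𝓡 3) ∞ X] [T2Space X]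
      [SecondCountableTopology X] [ConnectedSpace X] (D : InitialDataSet (𝓡 3) X)
      (𝒟 : VacuumCauchyDevelopment D) (O : Set 𝒟.carrier) (k : ℕ) (d : FinalStateDecomposition 𝒟.toSpacetime O k)
      (M a r₁ : ℝ) (φ : Kerr.slice a r₁ → X) (Rs : ℝ → ℝ) (Bs : Set X) (κ : ℝ),
      1 ≤ k →
      IsCompact Bs → 0 < κ → 0 ≤ M → |a| ≤ M → Continuous Rs → (∀ t, 16 * M + |a| + 1 ≤ Rs t) →
      (∀ t t' : ℝ, 0 ≤ t → t ≤ t' → Rs t' ≤ Rs t + 2 * (t' - t)) →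
      ({y : E4 | -1 < y 0 ∧ Rs (y 0) < E4.spatialNorm y} ⊆ (d.flatDomain : Set E4)) →
      (∀ y : d.flatDomain, -1 < y.1 0 → Rs (y.1 0) < E4.spatialNorm y.1 →
        𝒟.toSpacetime.deviation (Minkowski.backgroundOn d.flatDomain) d.flatChart y =
          gBL M a y.1 - Minkowski.bilin) →
      (∀ y : d.flatDomain, -1 < y.1 0 → Rs (y.1 0) < E4.spatialNorm y.1 →
        𝒟.timeOrientation.IsFutureDirected (mfderiv 𝓘(ℝ, E4) (𝓡 4) d.flatChart y (E4.basisVector 0))) →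
      Set.InjOn d.flatChart {y : d.flatDomain | 0 ≤ y.1 0} →
      IsOpenEmbedding φ → ContMDiff 𝓘(ℝ, E3) (𝓡 3) ∞ φ →
      (∀ ρ : ℝ, IsCompact (φ '' {x : Kerr.slice a r₁ | ρ < ‖(x : E3)‖})ᶜ) →
      (∀ (x : Kerr.slice a r₁) (hx : E4.ofTimeSpace 0 (x : E3) ∈ d.flatDomain), Rs 0 < ‖(x : E3)‖ →
        d.flatChart ⟨E4.ofTimeSpace 0 (x : E3), hx⟩ = 𝒟.embed (φ x)) →
      (𝒟.metric.causalFuture 𝒟.timeOrientation (range 𝒟.embed) ⊆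
        𝒟.metric.causalFuture 𝒟.timeOrientation (𝒟.embed '' Bs) ∪
          d.flatChart '' {y : d.flatDomain | 0 ≤ y.1 0 ∧ Rs (y.1 0) < E4.spatialNorm y.1}) →
      (∀ (i : Fin d.N) (z : E4), d.τ₀ ≤ z 0 →
        Kerr.radius (d.spin i) (poincareInv (d.motion i).1 (d.motion i).2 z) ≤ d.excision i (z 0) →
          E4.spatialNorm z + κ * z 0 ≤ Rs (z 0)) →
      HasCompleteNullInfinity 𝒟.toCauchyDevelopment := by
  intro blH toKS gBL X _ _ _ _ _ _ D 𝒟 O k d M a r₁ φ Rs Bs κ hk h1 h2 h3 h4 h5 h6 h7 h8 h9 h10 h11 h12 h13 h14 h15 h16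
    h17 inst
  obtain ⟨C, hC, δ₀, hδ₀, hZ'⟩ := stub_flatZoneSojourn
  obtain ⟨L, hL, hA'⟩ := stub_farExit X D 𝒟 O k d M a r₁ φ Rs Bs κ h1 h2 h3 h4 h5 h6 h7 h8 h9 h10 h11 h12 h13
    h14 h15 h16 h17
  refine ⟨Bs, h1, fun s hs ↦ ?_⟩
  -- the deviation size and the chart time budget
  set δ : ℝ := min δ₀ (1 / (2 * C * L * s)) with hδ_def
  have hδ : 0 < δ := lt_min hδ₀ (by positivity)
  have hδle : δ ≤ δ₀ := min_le_left _ _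
  have hδle' : δ ≤ 1 / (2 * C * L * s) := min_le_right _ _
  obtain ⟨τδ, hτδ⟩ : ∃ τδ : ℝ, ∀ τ', τδ ≤ τ' →
      𝒟.toSpacetime.deviationCk (Minkowski.backgroundOn d.flatDomain) d.flatChart k τ' ≤ ENNReal.ofReal δ := by
    have h := (ENNReal.tendsto_nhds_zero.1 d.tendsto_deviationCk_flat) (ENNReal.ofReal δ)
      (ENNReal.ofReal_pos.2 hδ)
    exact Filter.eventually_atTop.1 h
  set T : ℝ := 1 / (C * δ) with hT_def
  have hT : 0 ≤ T := by positivity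
  have hCδT : C * δ * T = 1 := by
    rw [hT_def]
    field_simp
  obtain ⟨B₁, hB₁, hray⟩ := hA' (max τδ ((4 * T + 2) / κ))
  refine ⟨B₁, hB₁, fun p hp γ dom hγ ↦ ?_⟩
  rcases hray p hp γ dom hγ with hcomplete | ⟨s₀, y, w, hτy, hexit⟩
  · exact Or.inl hcomplete
  right
  obtain ⟨hs₀dom, hs₀, hγy, hlate, hy0, hsph, hvel, hnull, hw0, hwL⟩ := hexit
  obtain ⟨hmem, hclear⟩ := stub_entryBookkeeping X D 𝒟 O k d Rs Bs κ h2 h7 h11 h16 h17 p γ dom hγ T s₀ y hs₀dom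
    hs₀ hγy hlate hy0 hsph hT
  have hclear' := hclear (le_trans (le_max_right _ _) hτy)
  have hdev : ∀ τ' : ℝ, y.1 0 ≤ τ' → τ' ≤ y.1 0 + T →
      𝒟.toSpacetime.deviationCk (Minkowski.backgroundOn d.flatDomain) d.flatChart 1 τ' ≤ ENNReal.ofReal δ := by
    intro τ' hτ' _
    exact le_trans (𝒟.toSpacetime.deviationCk_mono (Minkowski.backgroundOn d.flatDomain) d.flatChart hk τ')
      (hτδ τ' (le_trans (le_trans (le_max_left _ _) hτy) hτ'))
  have hstay := hZ' X D 𝒟 O k d γ dom hγ.isMaximalGeodesicOn s₀ y w L δ T hs₀dom hγy hlate hvel hnull hw0 hwL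
    hδ hδle hT hdev hclear'
  -- the sojourn bound
  set b : ℝ := (1 - Real.exp (-(C * δ * T))) / (C * δ * L) with hb_def
  have hCδL : 0 < C * δ * L := by positivity
  have hb : s ≤ b := by
    rw [hb_def, le_div_iff₀ hCδL, hCδT]
    have h₁ : s * (C * δ * L) ≤ 1 / 2 := by
      calc s * (C * δ * L) = (s * C * L) * δ := by ring
        _ ≤ (s * C * L) * (1 / (2 * C * L * s)) := by gcongr
        _ = 1 / 2 := by field_simp
    have h₂ := exp_neg_one_le_one_half
    linarith
  calc ENNReal.ofReal s ≤ ENNReal.ofReal b := ENNReal.ofReal_le_ofReal hb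
    _ = volume (Icc s₀ (s₀ + b)) := by rw [Real.volume_Icc, add_sub_cancel_left]
    _ ≤ sojournTime γ dom (𝒟.metric.causalFuture 𝒟.timeOrientation (𝒟.embed '' Bs)) := by
      unfold sojournTime
      exact measure_mono fun t ht ↦
        ⟨hstay t ht.1 ht.2, hs₀.trans ht.1, hmem t (hstay t ht.1 ht.2) ht.1⟩

/-- **THE REDUCTION of the crux to its core.** If, Christodoulou-generically in the admissible class, an
MGHD exists and every MGHD carries an honest `C⁴` fixed-radius decomposition of its self-determined exterior
(the crux's `Hc`/`Hf`, VERBATIM) which has one atlas at infinity for some Kerr end — the line's registered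
open-problem stub `stub_core` (`KerrEndedHonestSettlingGeneric`), written out in full — then
`StarvedNecks.HonestFixedRadiusSettling` holds: the MGHD clause is shared, CERT
(`hasCompleteNullInfinity_of_oneAtlas`) supplies complete `𝓘⁺` for every MGHD, the honest decomposition is
the crux's `∃ (O, d, R₀)` verbatim, and Christodoulou genericity is monotone in the property
(`Negative.isChristodoulouGeneric_mono`). Christodoulou, CQG 16 (1999) A23, p. A24 (genericity notion).
[folklore] -/
theorem honestFixedRadiusSettling_of_core :
    (let blH : ℝ → ℝ → ℝ → ℝ := fun M a r ↦
      Real.smoothTransition (r / (4 * M) - 1) *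
        ((M / Real.sqrt (M ^ 2 - a ^ 2)) *
            (Kerr.rPlus M a * Real.log (r - Kerr.rPlus M a) - Kerr.rMinus M a * Real.log (r - Kerr.rMinus M a)) -
          (M / Real.sqrt (M ^ 2 - a ^ 2)) *
            (Kerr.rPlus M a * Real.log (4 * M - Kerr.rPlus M a) -
              Kerr.rMinus M a * Real.log (4 * M - Kerr.rMinus M a)))
      let toKS : ℝ → ℝ → E4 → E4 := fun M a y ↦
      E4.ofTimeSpace (y 0 + blH M a (Kerr.radius a (E4.ofTimeSpace 0 (E4.spatial y)))) (E4.spatial y)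
      let gBL : ℝ → ℝ → E4 → E4 →L[ℝ] E4 →L[ℝ] ℝ := fun M a y ↦
      (Kerr.bilin M a (toKS M a y)).bilinearComp (fderiv ℝ (toKS M a) y) (fderiv ℝ (toKS M a) y)
      let Hc := ( fun (𝓢 : Spacetime.{0} 4) (O : Set 𝓢.carrier) (k : ℕ) (d : FinalStateDecomposition 𝓢 O k) (R₀ : ℝ) => let B := d.background; let t := fun i ↦ (B i).time; let r := fun i ↦ (B i).radius; let Ψ := d.chart; (∀ i, Kerr.IsSubextremal (d.mass i) (d.spin i) ∧ 100 * d.mass i ≤ R₀ ∧ 0 < ((d.motion i).1 : E4 ≃L[ℝ] E4) (E4.basisVector 0) 0) ∧ (∀ i (ϱ τ₂ : ℝ), R₀ ≤ ϱ → d.τ₀ < τ₂ → Ψ i '' {x | d.τ₀ < t i x.1 ∧ t i x.1 < τ₂ ∧ r i x.1 < ϱ} ⊆ 𝓢.metric.causalPast 𝓢.timeOrientation (Ψ i '' (B i).truncTimeSlab ϱ τ₂)) ∧ (∀ i (τ' : ℝ) (ϱ : ℝ → ℝ), Continuous ϱ → d.τ₀ < τ' → let A := Ψ i '' {x | τ'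 ≤ t i x.1 ∧ r i x.1 ≤ ϱ (t i x.1)}; closure A ∩ O ⊆ A) ∧ (∀ y : d.flatDomain, d.τ₀ < y.1 0 → 𝓢.timeOrientation.IsFutureDirected (mfderiv 𝓘(ℝ, E4) (𝓡 4) d.flatChart y (E4.basisVector 0))) ); let Hf := ( fun (𝓢 : Spacetime.{0} 4) (O : Set 𝓢.carrier) (k : ℕ) (d : FinalStateDecomposition 𝓢 O k) (R₀ : ℝ) => let B := d.background; let t := fun i ↦ (B i).time; let r := fun i ↦ (B i).radius; let Φ := d.flatChart; (∀ τ₂ : ℝ, d.τ₀ < τ₂ → Φ '' {y | d.τ₀ < y.1 0 ∧ y.1 0 < τ₂} ⊆ 𝓢.metric.causalPast 𝓢.timeOrientation (Φ '' (Minkowski.backgroundOn d.flatDomain).timeSlab τ₂)) ∧ (∀ τ' : ℝ, d.τ₀ < τ' → closure (Φ '' {y | τ' ≤ y.1 0 ∧ ∀ i, d.excision i (y.1 0) + 1 ≤ r i y.1}) ⊆ Φ '' {y | τ' ≤ y.1 0}) ∧ (∀ i, ∃ T : ℝ, supCkENorm (Subtype.val '' {x : (B i).domain | T ≤ t i x.1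 ∧ R₀ ≤ r i x.1 ∧ ∀ j, j ≠ i → r i x.1 ≤ r j x.1}) 0 (𝓢.deviationExtend (B i) (d.chart i)) ≤ ENNReal.ofReal (1 / (10 * ‖(((d.motion i).1 : E4 ≃L[ℝ] E4) : E4 →L[ℝ] E4)‖ ^ 2))) );
      ∀ (X : Type) [TopologicalSpace X] [ChartedSpace E3 X] [IsManifold (𝓡 3) ∞ X] [T2Space X]
        [SecondCountableTopology X] [ConnectedSpace X],
        InitialDataSet.IsChristodoulouGeneric (admissibleVacuumData X)
          (fun D ↦ (∃ 𝒟 : VacuumCauchyDevelopment D, 𝒟.IsMaximal) ∧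
            ∀ 𝒟 : VacuumCauchyDevelopment D, 𝒟.IsMaximal →
              ∃ (O : Set 𝒟.carrier) (d : FinalStateDecomposition 𝒟.toSpacetime O 4) (R₀ : ℝ),
                O = exteriorOf 𝒟.toCauchyDevelopment d.charted ∧ Hc 𝒟.toSpacetime O 4 d R₀ ∧ Hf 𝒟.toSpacetime O 4 d R₀ ∧
                ∃ (M a r₁ : ℝ) (φ : Kerr.slice a r₁ → X) (Rs : ℝ → ℝ) (Bs : Set X) (κ : ℝ),
            IsCompact Bs ∧ 0 < κ ∧ 0 ≤ M ∧ |a| ≤ M ∧ Continuous Rs ∧ (∀ t, 16 * M + |a| + 1 ≤ Rs t) ∧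
            (∀ t t' : ℝ, 0 ≤ t → t ≤ t' → Rs t' ≤ Rs t + 2 * (t' - t)) ∧
            ({y : E4 | -1 < y 0 ∧ Rs (y 0) < E4.spatialNorm y} ⊆ (d.flatDomain : Set E4)) ∧
            (∀ y : d.flatDomain, -1 < y.1 0 → Rs (y.1 0) < E4.spatialNorm y.1 →
            𝒟.toSpacetime.deviation (Minkowski.backgroundOn d.flatDomain) d.flatChart y =
            gBL M a y.1 - Minkowski.bilin) ∧
            (∀ y : d.flatDomain, -1 < y.1 0 → Rs (y.1 0) < E4.spatialNorm y.1 →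
            𝒟.timeOrientation.IsFutureDirected (mfderiv 𝓘(ℝ, E4) (𝓡 4) d.flatChart y (E4.basisVector 0))) ∧
            Set.InjOn d.flatChart {y : d.flatDomain | 0 ≤ y.1 0} ∧
            IsOpenEmbedding φ ∧ ContMDiff 𝓘(ℝ, E3) (𝓡 3) ∞ φ ∧
            (∀ ρ : ℝ, IsCompact (φ '' {x : Kerr.slice a r₁ | ρ < ‖(x : E3)‖})ᶜ) ∧
            (∀ (x : Kerr.slice a r₁) (hx : E4.ofTimeSpace 0 (x : E3) ∈ d.flatDomain), Rs 0 < ‖(x : E3)‖ →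
            d.flatChart ⟨E4.ofTimeSpace 0 (x : E3), hx⟩ = 𝒟.embed (φ x)) ∧
            (𝒟.metric.causalFuture 𝒟.timeOrientation (range 𝒟.embed) ⊆
            𝒟.metric.causalFuture 𝒟.timeOrientation (𝒟.embed '' Bs) ∪
            d.flatChart '' {y : d.flatDomain | 0 ≤ y.1 0 ∧ Rs (y.1 0) < E4.spatialNorm y.1}) ∧
            (∀ (i : Fin d.N) (z : E4), d.τ₀ ≤ z 0 →
            Kerr.radius (d.spin i) (poincareInv (d.motion i).1 (d.motion i).2 z) ≤ d.excision i (z 0) →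
            E4.spatialNorm z + κ * z 0 ≤ Rs (z 0))) 1) →
    Summit.FinalStateConjecture.FinalStateConjecture.Theses.StarvedNecks.HonestFixedRadiusSettling := by
  intro hcore X _ _ _ _ _ _
  refine HonestFixedRadiusSettling.Negative.isChristodoulouGeneric_mono ?_ (hcore X)
  rintro D - ⟨hex, hall⟩
  refine ⟨hex, fun 𝒟 h𝒟 ↦ ?_⟩
  obtain ⟨O, d, R₀, hO, hc, hf, M, a, r₁, φ, Rs, Bs, κ, h1, h2, h3, h4, h5, h6, h7, h8, h9, h10, h11, h12, h13, h14,
    h15, h16, h17⟩ := hall 𝒟 h𝒟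
  exact ⟨hasCompleteNullInfinity_of_oneAtlas X D 𝒟 O 4 d M a r₁ φ Rs Bs κ (by norm_num) h1 h2 h3 h4 h5 h6 h7 h8 h9
    h10 h11 h12 h13 h14 h15 h16 h17, O, d, R₀, hO, hc, hf⟩

end Summit.FinalStateConjecture.FinalStateConjecture.Theorems.StarvedNecks.OneOverDelta
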